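import Summits.ResolutionOfSingularities.ResolutionOfSingularities.Theorems.EquisingularLiftEquisingularLiftReducedStrictTransformBlowup
import Literature.AlgebraicGeometry.Resolution.BlowupsLocal
import Literature.AlgebraicGeometry.Resolution.BlowupsProperProofs
import Literature.AlgebraicGeometry.Resolution.ResolutionGlue
import HarnessLib

/-!
# `EquisingularLift` (stmt-ResolutionOfSingularities-15660), line `Sketch` v10b — the reduced strict transform of a
# re-embedded scheme with a regular blow-up model is regular

[OURS · L1 W4.5b] Helper for the registered stub `stub_linearCentre_of_blowupModel` of the crux `EquisingularLift`; NOT a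
statement of any manuscript.

Let `j : H → X` be a closed immersion of an integral scheme into a locally Noetherian scheme, `Λ` an ideal sheaf on `X`
with `j(H) ⊄ V(Λ)`, and suppose every blow-up of `H` along `Λ · 𝒪_H = Λ.comap j` is regular (a regular blow-up model).
Then for every blow-up `τ₀ : W → X` of `X` along `Λ`, the reduced closed subscheme of `W` on the strict-transform set
`closure τ₀⁻¹(j(H) ∖ V(Λ))` is regular: by p167331 (`exists_isBlowup_reducedStrictTransform`, Hartshorne II.7.15 /
Stacks 080E) it is a blow-up of `V(j(H))_red ≅ H` along `Λ · 𝒪`, and blow-ups are transported along the isomorphism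
`H ≅ V(j(H))_red` (`IsBlowup.comp_iso`).
-/

set_option linter.dupNamespace false -- mandated namespace `Summit.<Summit>.<Problem>` of this single-conjunct summit

noncomputable section

open CategoryTheory CategoryTheory.Limits AlgebraicGeometry TopologicalSpace
open Literature.AlgebraicGeometry.Resolution
open AlgebraicGeometry.Scheme.IdealSheafData

namespace Summit.ResolutionOfSingularities.ResolutionOfSingularities.Cruxes.EquisingularLift.StrataSplit

namespace LinearCentre

/-- **The reduced strict transform of `j(H)` under a blow-up along `Λ` is regular when all blow-ups of `H` along
`Λ · 𝒪_H` are regular** (`j : H → X` a closed immersion, `H` integral, `j(H) ⊄ V(Λ)`). [OURS · L1 W4.5b]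
[cite: Hartshorne1977, II Cor. 7.15] -/
theorem isRegular_reducedStrictTransform_of_blowupModel {X W H : Scheme.{0}} [IsLocallyNoetherian X]
    (j : H ⟶ X) [IsClosedImmersion j] [IsIntegral H] (Λ : X.IdealSheafData)
    (hnot : ¬ (Set.range j ⊆ (Λ.support : Set X)))
    (hreg : ∀ (Z : Scheme.{0}) (π : Z ⟶ H), IsBlowup π (Λ.comap j) → Scheme.IsRegular Z)
    (τ₀ : W ⟶ X) (hτ₀ : IsBlowup τ₀ Λ) :
    Scheme.IsRegular (vanishingIdeal (⟨closure (τ₀ ⁻¹' (Set.range j \ (Λ.support : Set X))),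
      isClosed_closure⟩ : Closeds W)).subscheme := by
  haveI : IsProper τ₀ := hτ₀.isProper
  haveI : IsLocallyNoetherian W := LocallyOfFiniteType.isLocallyNoetherian τ₀
  have hS : IsClosed (Set.range j) := j.isClosedEmbedding.isClosed_range
  have hirr : IsIrreducible (Set.range j) := by
    have h := (IrreducibleSpace.isIrreducible_univ H).image j j.continuous.continuousOn
    rwa [Set.image_univ] at h
  obtain ⟨ρ, -, -, hblow⟩ := exists_isBlowup_reducedStrictTransform X W τ₀ Λ hτ₀ (Set.range j) hS hirr hnot
  -- `H ≅ V(j(H))_red`: a closed immersion from a reduced scheme has kernel the vanishing ideal sheaf of its range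
  let T : Closeds X := ⟨Set.range j, hS⟩
  have hTker : vanishingIdeal T = j.ker := by
    -- adapted from `stub_projectiveAmbientFibre` (p160143)
    rw [← Scheme.IdealSheafData.map_bot, ← Scheme.nilradical_eq_bot, ← Scheme.IdealSheafData.vanishingIdeal_top,
      Scheme.IdealSheafData.map_vanishingIdeal]
    congr 1
    ext1
    change Set.range j = closure (j '' Set.univ)
    rw [Set.image_univ, j.isClosedEmbedding.isClosed_range.closure_eq]
  have hker : (vanishingIdeal T).subschemeι.ker = j.ker := by
    rw [Scheme.IdealSheafData.ker_subschemeι, hTker]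
  haveI := IsClosedImmersion.isIso_lift _ j hker
  let e : H ≅ (vanishingIdeal T).subscheme := asIso (IsClosedImmersion.lift _ j hker.le)
  have hefac : e.hom ≫ (vanishingIdeal T).subschemeι = j := IsClosedImmersion.lift_fac _ j hker.le
  -- transport the blow-up along `e`
  have h2 : IsBlowup (ρ ≫ e.symm.hom) ((Λ.comap (vanishingIdeal T).subschemeι).comap e.symm.inv) :=
    hblow.comp_iso e.symm
  rw [Iso.symm_inv, ← Scheme.IdealSheafData.comap_comp, hefac] at h2
  exact hreg _ _ h2

end LinearCentre

end Summit.ResolutionOfSingularities.ResolutionOfSingularities.Cruxes.EquisingularLift.StrataSplit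

end
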